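import Summits.Ventures.AbcSig.Rows.Bridge
import Summits.Ventures.AbcSig.Rows.C2aL307A6Q
import Summits.Ventures.AbcSig.Rows.C2aL307A6QAB

/-!
# Venture AbcSig — CELL `C2aL307A6`: the census statement `Rows.C2aCellRed 307 (fun a => 6 ≤ a) ∅` from the two row theorems

Q-VARIANT (p-lean g6 `gen6/spatch2.py`) of `xcell_C2aL307A6`: kernel sieve discharges (q = 2 rule, one extra named hypothesis hQ : M.Q2Package) replace the cited pair(s) 307.4 @ 11 (see the row file(s) `Rows/C2aL307A6Q.lean`, `Rows/C2aL307A6QAB.lean`).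
HONEST FRAMING. COMPUTATION cell `pub-abcsig`; CONDITIONAL theorem; no claim on ABC or any summit. Hypotheses exactly as
in `Rows/C2aL307A6X.lean` and `Rows/C2aL307A6XAB.lean`: `BS04Package` (CITED), `DataComplete …` (COMPUTED level files), `EisPackage` (CITED) and `Refines` (COMPUTED) for the M6 orbits discharged in the kernel, and the
rows' per-orbit exclusions for BOTH family predicates (`famB`, `famAB`) as universally quantified hypotheses (CITED: the census
row's certificates). Conclusion = p1's census predicate (`Rows/Statements.lean`), all four coprime coefficient
distributions `A·B = 2^a·307^m`, reduced exponents `a < n`, `m < n` (RULING H1). GENERATED by p-lean g2 gen/make_rows.py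
(after plean/make_cell_bridges.py).
-/

namespace Summit.Ventures.AbcSig

/-- Cell `C2aL307A6` (M6 orbits discharged in the kernel): `Rows.C2aCellRed 307 (fun a => 6 ≤ a) ∅` under the rows' hypotheses. -/
theorem xcell_C2aL307A6Q (M : NewformModel) (hP : M.BS04Package) (hQ : M.Q2Package)
    (hE : M.EisPackage)
    (hD307 : M.DataComplete 307 level307Orbits)
    (hD614 : M.DataComplete 614 level614Orbits)
    (hR_orbit_307_6 : M.Refines 307 orbit_307_6 m6X_307_6)
    (hQ2_orbit_307_4 : ∀ f : M.Form 307, M.Matches f orbit_307_4 → M.Matches f q2_307_4)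
    (hX_orbit_614_6 : ∀ n a m : ℕ, n ∈ ([11] : List ℕ) → M.Excludes 614 orbit_614_6 (famB (2 ^ a * 307 ^ m) n (fun _ _ => True)))
    (hX_orbit_614_6' : ∀ n a m : ℕ, n ∈ ([11] : List ℕ) → M.Excludes 614 orbit_614_6 (famAB (307 ^ m) (2 ^ a) n (fun _ _ => True))) :
    Rows.C2aCellRed 307 (fun a => 6 ≤ a) ∅ :=
  C2aCellRed_of_rows 307 (by norm_num) (by norm_num) _ _
    (fun n hn h11 hnℓ _ a m ha han hm hmn x y z h1 h2 =>
      xrow_C2aL307A6Q M hP hQ hE hD307 hD614 hR_orbit_307_6 n hn h11 hnℓ a m ha hm han hmn hQ2_orbit_307_4 (hX_orbit_614_6 n a m) x y z h1 h2)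
    (fun n hn h11 hnℓ _ a m ha han hm hmn x y z h1 h2 =>
      xrow_C2aL307A6QAB M hP hQ hE hD307 hD614 hR_orbit_307_6 n hn h11 hnℓ a m ha hm han hmn hQ2_orbit_307_4 (hX_orbit_614_6' n a m) x y z h1 h2)

end Summit.Ventures.AbcSig
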